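import Mathlib
import Summits.Ventures.CertifiedManyBodySolver.Theses.M3PrimeEdgeSplit

/-!
# U∞-TWIN — exact-target fitness at the extremal cell (U = ∞, n = 7/8) for the (d,D)-family search
(crux idea for `M3PrimeEdgeSplit.LowerEdge_ge_m4o5`, first lemmas; hub-lb-idea-9 g0, lens «extremal-example mining»)

The instrument in one line: re-solve a NESTED pair of lower relaxations (base ⊂ base ⊕ W) with the U = ∞ edit
(objective U·D ↦ 0, row D = 0). The polarised Slater state at density 7/8 is feasible for both, so both values sit
below the exact free-fermion number e_FM(1/8) = −0.408100 t, and the captured fraction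
φ(W) = (v_W − v_base)/(e_FM − v_base) ∈ [0, 1] scores the word family W against an EXACT target — the pure
hole-statistics excess X(∞) = −4tδ − e_FM = 0.0919 that no finite-window relaxation of record sees.
Below: (1) cell value ≤ objective of any feasible witness; (2) nesting raises a greatest lower bound; (3) φ ∈ [0,1];
(4) lower bounds transfer UPWARD in U only (so the cell certifies nothing at U = 8 — it is a fitness, not a floor);
(5) what does close the crux. FLOAT/diagnostic use only; nothing here is a certified number.
-/

namespace Summit.Ventures.CertifiedManyBodySolver.Cruxes.LowerEdge_ge_m4o5.UinfTwin

/-- (1) A relaxation value lies below the objective of every feasible point — in particular below the objective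
of the polarised Slater witness when it is feasible (the DIAGNOSTIC reading of the U = ∞ cell: `v ≤ e_FM`). -/
theorem cell_le_of_witness {Y : Type*} (Feas : Set Y) (obj : Y → ℝ) (v : ℝ)
    (hv : ∀ y ∈ Feas, v ≤ obj y) {w : Y} (hw : w ∈ Feas) : v ≤ obj w :=
  hv w hw

/-- (2) Nesting: adding constraints (`Feas₁ ⊆ Feas₀`, i.e. base ⊕ W ⊆ base as feasible sets) can only raise the
greatest lower bound, so `v_base ≤ v_W`. -/
theorem glb_mono_of_subset {Y : Type*} {Feas₀ Feas₁ : Set Y} (h : Feas₁ ⊆ Feas₀) (obj : Y → ℝ)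
    {v₀ v₁ : ℝ} (h₀ : IsGLB (obj '' Feas₀) v₀) (h₁ : IsGLB (obj '' Feas₁) v₁) : v₀ ≤ v₁ := by
  refine h₁.2 ?_
  rintro x ⟨y, hy, rfl⟩
  exact h₀.1 ⟨y, h hy, rfl⟩

/-- (3) The captured fraction of a nested pair against an exact target `e` (`v₀ ≤ v₁ ≤ e`, `v₀ < e`) lies in
`[0, 1]`; it is the fitness `φ(W)` of the word family `W`. -/
theorem capturedFraction_mem_Icc {v₀ v₁ e : ℝ} (h01 : v₀ ≤ v₁) (h1e : v₁ ≤ e) (h0e : v₀ < e) :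
    (v₁ - v₀) / (e - v₀) ∈ Set.Icc (0 : ℝ) 1 := by
  have hpos : 0 < e - v₀ := sub_pos.mpr h0e
  constructor
  · exact div_nonneg (sub_nonneg.mpr h01) hpos.le
  · rw [div_le_one hpos]
    linarith

/-- (4) Honesty lemma: with `obj_U = T + U·D` and `D ≥ 0` on the feasible set, a floor valid at coupling `U` is a
floor at every `U' ≥ U` — lower bounds move UP the U-axis only. Hence a U = ∞ cell value bounds nothing at U = 8
from below; the twin is an exact-target FITNESS for choosing words, not a certificate. -/
theorem floor_mono_in_U {Y : Type*} (Feas : Set Y) (T D : Y → ℝ) (hD : ∀ y ∈ Feas, 0 ≤ D y)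
    {U U' v : ℝ} (hUU' : U ≤ U') (hv : ∀ y ∈ Feas, v ≤ T y + U * D y) :
    ∀ y ∈ Feas, v ≤ T y + U' * D y := by
  intro y hy
  have h1 := hv y hy
  have h2 := mul_le_mul_of_nonneg_right hUU' (hD y hy)
  linarith

/-- (5) What closes the crux is a certified floor at (8, 7/8, 0): any rational `lo ≥ -4/5` carrying
`M3EnergyLowerRow 0 lo` proves `LowerEdge_ge_m4o5` (by name the leaf `M3Lower_tp0_ge_m4o5`). The words the
fitness selects must still be solved and certified at U = 8 to produce such a `lo`. -/
theorem crux_of_certified_floor (lo : ℚ) (hlo : (-4/5 : ℚ) ≤ lo) (h : M3EnergyLowerRow 0 lo) :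
    Summit.Ventures.CertifiedManyBodySolver.Theses.M3PrimeEdgeSplit.LowerEdge_ge_m4o5 := by
  unfold Summit.Ventures.CertifiedManyBodySolver.Theses.M3PrimeEdgeSplit.LowerEdge_ge_m4o5
    Summit.Ventures.CertifiedManyBodySolver.MbsolverRungLeaves.M3Lower_tp0_ge_m4o5
  exact ⟨lo, hlo, h⟩

end Summit.Ventures.CertifiedManyBodySolver.Cruxes.LowerEdge_ge_m4o5.UinfTwin
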